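import Literature.NumberTheory.EllipticCurves.Kobayashi2003.FineSelmerLeSignedSelmerProofs
import Summits.BirchSwinnertonDyer.Rank1Residual.Additive.ClassicalConditionAwayBadPlaces
import HarnessLib

/-!
# Route `ThetaPartnerAtTwo` (TP2), crux K3 `SignedKatoDivisibilityUpToAtTwo` (item stmt-BirchSwinnertonDyer-20308),
# line `colemanrat` v3 — FIRST BRICK of the (PT) RECIPROCITY clause: a class of `H¹(K_∞, E[p^∞])` that is LOCALLY TRIVIAL
# over `K_∞` at finitely many finite places `S` comes from a FINITE layer `K_m` by a class that is already locally trivial AT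
# LAYER `m` at every place of `K_m` above `S`, and satisfies the classical local conditions at layer `m` at every good `v ∤ p`
# outside `S` and at the infinite places whenever the given class does over `K_∞`. For `s ∈ Sel_{p^∞}(E/K_∞)` and `S` = any finite
# set of places `v ∤ p`: the away-from-`p` local terms of Poitou–Tate at layer `m` VANISH (crux memo W3G2-RECIPROCITY-ROADMAP §3 (a)).

Width seat `bsd-wall-tp2-p2x-w3` g2 (cell `bsd-wall`). HONEST FRAMING: THEOREMS ONLY — no definition, no named fact, no instance,
no `sorry`; route-independent; any number field `K`, prime `p`, `ℤ_p`-extension `κ`, elliptic `W/K`; closes no item; BSD is NOT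
proved by any of this.

## What is proved

* §1 `exists_layer_forall_resOfLe_conjH1_eq_zero` — for `s ∈ H¹(K_∞, E[p^∞])` and a finite set `S` of finite places with
  `res_{Γ_∞ ⊓ D_v}(conj_σ s) = 0` for all `v ∈ S`, `σ ∈ Γ_K`: there are `m` and `c ∈ H¹(K_m, E[p^∞])` with `h_m c = s` and
  `res_{Γ_m ⊓ D_v}(conj_σ c) = 0` for all `v ∈ S`, `σ` — and moreover `conj_σ c` satisfies the classical local condition at layer `m`
  at every GOOD `v ∤ p` (resp. every infinite `w`) at which `conj_σ s` satisfies it over `K_∞`. Proof = the skeleton of the tree's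
  `Kobayashi2003.fineSelmerInfty_le_signedSelmerInfty` (Greenberg's Lemma 3.2: `s = h_n y`; finitely many cosets `Γ_K/Γ_n` and
  places; compactness `exists_layer_principal`; Greenberg's Lemma 3.3 `localTowerKerPrimary_eq_bot_of_hasGoodReductionAt` at the good
  places; archimedean places split) with the condition at `p` removed and the exceptional set a parameter.
* §2 `exists_selmer_layer_rep_awayTrivial` — for `s ∈ Sel_{p^∞}(E/K_∞)` and finite `S ⊆ {v ∤ p}`: `∃ m c`, `h_m c = s`, `c` classically
  Selmer at layer `m` at every finite `v ∤ p` with good reduction and at every infinite place, and LOCALLY TRIVIAL at layer `m` above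
  `S` (the classical condition over `K_∞` at `v ∤ p` is local triviality: `Additive.localKerOver_le_awayKer`); signed version
  `exists_signedSelmer_layer_rep_awayTrivial` (`Sel^ε ≤ Sel`).

References: [GreenbergLNM1716] §3 Lemmas 3.2–3.3 (p. 86), §2 Prop. 2.1 (p. 72); [SerreGaloisCohomology1997] I §2.2 Prop. 8;
[Kobayashi2003] (7.16)–(7.21) (p. 12: the local terms at `v ∤ p` vanish, «`E(K_{n,v}) ⊗ ℚ_p/ℤ_p = 0` for the places `v` not lying above `p`»).
-/

set_option autoImplicit false
-- the Theorems namespace of this sub repeats the summit name by design (D-0017 nested layout)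
set_option linter.dupNamespace false

noncomputable section

open scoped Classical

namespace Summit.BirchSwinnertonDyer.BirchSwinnertonDyer.Theorems

namespace SignedKatoOffTwo.LayerRep

open NumberField IsDedekindDomain Field Filter Topology WeierstrassCurve
  Literature.NumberTheory.EllipticCurves Literature.NumberTheory.EllipticCurves.GreenbergSelmer
  Literature.NumberTheory.EllipticCurves.Kobayashi2003 Literature.NumberTheory.GaloisRepresentations ZpExtension
  Summit.BirchSwinnertonDyer.Rank1Residual.Additive

universe u

/-- Finite uniformisation (bookkeeping): finitely many monotone eventually-true properties of the layer index hold simultaneously at one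
layer. [folklore] -/
theorem exists_forall_of_finite' {ι : Type*} [Finite ι] {P : ι → ℕ → Prop} (n : ℕ)
    (hmono : ∀ i {m m' : ℕ}, m ≤ m' → P i m → P i m') (h : ∀ i, ∃ m, n ≤ m ∧ P i m) :
    ∃ m, n ≤ m ∧ ∀ i, P i m := by
  classical
  haveI := Fintype.ofFinite ι
  choose f hf using h
  refine ⟨max n (Finset.univ.sup f), le_max_left _ _, fun i ↦ hmono i ?_ (hf i).2⟩
  exact (Finset.le_sup (f := f) (Finset.mem_univ i)).trans (le_max_right _ _)

variable {K : Type u} [Field K] [NumberField K] (W : WeierstrassCurve K) [W.IsElliptic] (p : ℕ) [Fact p.Prime]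
  (κ : ZpExtension K p)

/-! ## §1 Layer representatives locally trivial at finitely many places -/

/-- **Layer representative, locally trivial above `S` at the layer.** Let `s ∈ H¹(K_∞, E[p^∞])` and `S` a finite set of finite places
of `K` such that `res_{Gal(K̄/K_∞) ⊓ D_v}(conj_σ s) = 0` for every `v ∈ S` and every `σ ∈ Γ_K` (local triviality over `K_∞` at every place
above `S`). Then for some layer `m` and some `c ∈ H¹(K_m, E[p^∞])` with `h_m c = s`: (i) `res_{Gal(K̄/K_m) ⊓ D_v}(conj_σ c) = 0` for all
`v ∈ S`, `σ` (local triviality AT LAYER `m` above `S`); (ii) at every finite `v ∉ S`, `v ∤ p`, of GOOD reduction: if `conj_σ s` satisfies the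
classical local condition over `K_∞` then `conj_σ c` satisfies it at layer `m`; (iii) likewise at every infinite place.
[cite: GreenbergLNM1716, §3 Lemmas 3.2–3.3 (p. 86)] [cite: SerreGaloisCohomology1997, I §2.2 Prop. 8] -/
theorem exists_layer_forall_resOfLe_conjH1_eq_zero (s : W.subgroupH1 p κ.kerSubgroup)
    (S : Finset (HeightOneSpectrum (𝓞 K)))
    (hS : ∀ v ∈ S, ∀ σ : absoluteGaloisGroup K,
      resOfLe (W.geomPrimaryTorsion p) (inf_le_left : κ.kerSubgroup ⊓ decomp v ≤ κ.kerSubgroup)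
        (W.conjH1 p κ.kerSubgroup σ s) = 0) :
    ∃ (m : ℕ) (c : W.subgroupH1 p (κ.layerSubgroup m)), W.layerToInfty κ m c = s ∧
      (∀ v ∈ S, ∀ σ : absoluteGaloisGroup K,
        resOfLe (W.geomPrimaryTorsion p) (inf_le_left : κ.layerSubgroup m ⊓ decomp v ≤ κ.layerSubgroup m)
          (W.conjH1 p (κ.layerSubgroup m) σ c) = 0) ∧
      (∀ (v : HeightOneSpectrum (𝓞 K)), v ∉ S → W.HasGoodReductionAt v → (p : 𝓞 K) ∉ v.asIdeal →
        ∀ σ : absoluteGaloisGroup K, W.conjH1 p κ.kerSubgroup σ s ∈ W.localKerOver p κ.kerSubgroup (v.adicCompletion K) →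
          W.conjH1 p (κ.layerSubgroup m) σ c ∈ W.localKerOver p (κ.layerSubgroup m) (v.adicCompletion K)) ∧
      (∀ (w : InfinitePlace K) (σ : absoluteGaloisGroup K),
        W.conjH1 p κ.kerSubgroup σ s ∈ W.localKerOver p κ.kerSubgroup w.Completion →
          W.conjH1 p (κ.layerSubgroup m) σ c ∈ W.localKerOver p (κ.layerSubgroup m) w.Completion) := by
  classical
  -- (1) `s = h_n y` for some layer `n` (Greenberg's Lemma 3.2 in the tree + continuity)
  obtain ⟨γ, hγ⟩ : ∃ γ : absoluteGaloisGroup K, κ.IsTopGenerator γ := κ.surjective (Multiplicative.ofAdd 1)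
  obtain ⟨n, hn⟩ := W.exists_conjH1_pow_prime_pow_eq κ hγ s
  have hprim : ∀ x : W.geomPrimaryTorsion p, ∃ k : ℕ, p ^ k • x = 0 := fun x ↦ by
    obtain ⟨k, hk⟩ := x.2
    exact ⟨k, Subtype.ext (by rw [AddSubgroupClass.coe_nsmul, hk, ZeroMemClass.coe_zero])⟩
  obtain ⟨y, hy⟩ := AddMonoidHom.mem_range.1 (ZpExtension.mem_range_resOfLe_of_conjH1_eq κ hγ n
    (W.continuous_smul_geomPrimaryTorsion p) hprim s hn)
  have hys : W.layerToInfty κ n y = s := hy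
  subst hys
  -- (2) conjugates through the finite quotient `Γ_K / Γ_n`
  haveI : Finite (absoluteGaloisGroup K ⧸ κ.layerSubgroup n) :=
    Subgroup.quotient_finite_of_isOpen _ (κ.isOpen_layerSubgroup n)
  have hconj_rep : ∀ σ : absoluteGaloisGroup K, W.conjH1 p (κ.layerSubgroup n) σ y =
      W.conjH1 p (κ.layerSubgroup n) ((σ : absoluteGaloisGroup K ⧸ κ.layerSubgroup n).out) y := by
    intro σ
    obtain ⟨h, hh⟩ := QuotientGroup.mk_out_eq_mul (κ.layerSubgroup n) σ
    rw [hh, W.conjH1_mul_holds p (κ.layerSubgroup n) σ h, AddMonoidHom.comp_apply,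
      W.conjH1_of_mem_holds p (κ.layerSubgroup n) h.2, AddMonoidHom.id_apply]
  choose φ hφ using fun q : absoluteGaloisGroup K ⧸ κ.layerSubgroup n ↦
    oneCocycleClass_surjective (discreteTopRep (κ.layerSubgroup n) (W.geomPrimaryTorsion p))
      (W.conjH1 p (κ.layerSubgroup n) q.out y)
  -- (3) at each (coset, place of `S`): principal on `Γ_m ⊓ D_v` from some layer `m` on
  have hkey : ∀ (q : absoluteGaloisGroup K ⧸ κ.layerSubgroup n) (v : S),
      ∃ m, n ≤ m ∧ ∃ t : W.geomPrimaryTorsion p,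
        ∀ (g : absoluteGaloisGroup K) (hg : g ∈ κ.layerSubgroup n), g ∈ κ.layerSubgroup m →
          g ∈ decomp (K := K) v.1 → (φ q).1 ⟨g, hg⟩ = g • t - t := by
    intro q v
    have h0 : resOfLe (W.geomPrimaryTorsion p)
        (inf_le_left : κ.kerSubgroup ⊓ decomp (K := K) v.1 ≤ κ.kerSubgroup)
        (W.conjH1 p κ.kerSubgroup q.out (W.layerToInfty κ n y)) = 0 := hS v.1 v.2 q.out
    rw [← W.layerToInfty_conjH1 κ, ← hφ q] at h0
    obtain ⟨t, ht⟩ := exists_principal_of_resOfLe_resOfLe_eq_zero W p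
      (κ.kerSubgroup_le_layerSubgroup n) inf_le_left (φ q) h0
    obtain ⟨m, hnm, hm⟩ := exists_layer_principal W p κ (isCompact_decomp v.1) (φ q) t
      (fun g hg hgk hgD ↦ ht g hg (Subgroup.mem_inf.2 ⟨hgk, hgD⟩))
    exact ⟨m, hnm, t, hm⟩
  -- (4) ONE layer `m` for all cosets and all places of `S`
  obtain ⟨m, hnm, hm⟩ : ∃ m, n ≤ m ∧
      ∀ i : (absoluteGaloisGroup K ⧸ κ.layerSubgroup n) × (S : Set (HeightOneSpectrum (𝓞 K))),
        ∃ t : W.geomPrimaryTorsion p,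
          ∀ (g : absoluteGaloisGroup K) (hg : g ∈ κ.layerSubgroup n), g ∈ κ.layerSubgroup m →
            g ∈ decomp (K := K) i.2.1 → (φ i.1).1 ⟨g, hg⟩ = g • t - t :=
    exists_forall_of_finite' n
      (fun i m m' hmm' ⟨t, ht⟩ ↦ ⟨t, fun g hg hgm' hgD ↦ ht g hg (κ.layerSubgroup_antitone hmm' hgm') hgD⟩)
      (fun i ↦ hkey i.1 ⟨i.2.1, i.2.2⟩)
  -- (5) the class at layer `m` and its conjugates
  have hym_inf : W.layerToInfty κ m (W.resOfLe p (κ.layerSubgroup_antitone hnm) y) = W.layerToInfty κ n y := by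
    show W.resOfLe p _ (W.resOfLe p _ y) = W.resOfLe p _ y
    rw [← AddMonoidHom.comp_apply, W.resOfLe_comp_holds p]
  have hconj_m : ∀ σ : absoluteGaloisGroup K,
      W.conjH1 p (κ.layerSubgroup m) σ (W.resOfLe p (κ.layerSubgroup_antitone hnm) y) =
        W.resOfLe p (κ.layerSubgroup_antitone hnm)
          (oneCocycleClass _ (φ (σ : absoluteGaloisGroup K ⧸ κ.layerSubgroup n))) := by
    intro σ
    rw [hφ, ← hconj_rep σ]
    exact (congrArg (fun f ↦ f y) (resOfLe_comp_conjH1_holds (M := W.geomPrimaryTorsion p)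
      (κ.layerSubgroup_antitone hnm) σ)).symm
  obtain ⟨k, hk⟩ : ∃ k : ℕ, p ^ k • W.resOfLe p (κ.layerSubgroup_antitone hnm) y = 0 := by
    haveI : CompactSpace (κ.layerSubgroup m) := isCompact_iff_compactSpace.mp
      ((κ.layerSubgroup m).isClosed_of_isOpen (κ.isOpen_layerSubgroup m)).isCompact
    obtain ⟨ψ, hψ⟩ := oneCocycleClass_surjective _ (W.resOfLe p (κ.layerSubgroup_antitone hnm) y)
    obtain ⟨k, hk⟩ := IwasawaDual.exists_pow_smul_oneCocycleClass_eq_zero (p := p) ψ fun σ ↦ hprim (ψ.1 σ)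
    exact ⟨k, by rw [← hψ]; exact hk⟩
  refine ⟨m, W.resOfLe p (κ.layerSubgroup_antitone hnm) y, hym_inf, fun v hv σ ↦ ?_, fun v hvS hgood hpv σ hσ ↦ ?_,
    fun w σ hσ ↦ ?_⟩
  · -- (i) locally trivial at layer `m` above `S`
    obtain ⟨t, ht⟩ := hm ⟨(σ : absoluteGaloisGroup K ⧸ κ.layerSubgroup n), ⟨v, hv⟩⟩
    rw [hconj_m σ]
    have hcomp : (resOfLe (W.geomPrimaryTorsion p)
          (inf_le_left : κ.layerSubgroup m ⊓ decomp v ≤ κ.layerSubgroup m)).comp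
        (W.resOfLe p (κ.layerSubgroup_antitone hnm)) =
        resOfLe (W.geomPrimaryTorsion p)
          ((inf_le_left : κ.layerSubgroup m ⊓ decomp v ≤ κ.layerSubgroup m).trans (κ.layerSubgroup_antitone hnm)) :=
      resOfLe_comp_holds (M := W.geomPrimaryTorsion p) _ _
    have happ := congrArg (fun f ↦ f (oneCocycleClass _ (φ (σ : absoluteGaloisGroup K ⧸ κ.layerSubgroup n)))) hcomp
    simp only [AddMonoidHom.comp_apply] at happ
    rw [happ, Literature.NumberTheory.EllipticCurves.resOfLe, resH1Hom_oneCocycleClass, oneCocycleClass_eq_zero_iff]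
    refine ⟨t, fun g ↦ ?_⟩
    have hg := Subgroup.mem_inf.1 g.2
    exact ht g (κ.layerSubgroup_antitone hnm hg.1) hg.1 hg.2
  · -- (ii) good place `v ∤ p` outside `S`: Greenberg's Lemma 3.3 at layer `m`
    have hinf : W.conjH1 p κ.kerSubgroup σ
        (W.layerToInfty κ m (W.resOfLe p (κ.layerSubgroup_antitone hnm) y)) ∈
          W.localKerOver p κ.kerSubgroup (v.adicCompletion K) := by rw [hym_inf]; exact hσ
    have htow := W.localResOver_conjH1_mem_localTowerKer κ (v.adicCompletion K) _ σ hinf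
    have hprimary : W.localResOver p (κ.layerSubgroup m) (v.adicCompletion K)
        (W.conjH1 p (κ.layerSubgroup m) σ (W.resOfLe p (κ.layerSubgroup_antitone hnm) y)) ∈
          W.localTowerKerPrimary κ (v.adicCompletion K) m :=
      (W.mem_localTowerKerPrimary_iff κ (v.adicCompletion K) m _).2
        ⟨htow, k, by rw [← map_nsmul, ← map_nsmul, hk, map_zero, map_zero]⟩
    rw [Greenberg1999.localTowerKerPrimary_eq_bot_of_hasGoodReductionAt W κ hpv hgood m, AddSubgroup.mem_bot] at hprimary
    rw [WeierstrassCurve.mem_localKerOver_iff]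
    exact hprimary
  · -- (iii) archimedean place: splits completely in `K_∞/K`
    have hinf : W.conjH1 p κ.kerSubgroup σ
        (W.layerToInfty κ m (W.resOfLe p (κ.layerSubgroup_antitone hnm) y)) ∈
          W.localKerOver p κ.kerSubgroup w.Completion := by rw [hym_inf]; exact hσ
    have htow := W.localResOver_conjH1_mem_localTowerKer κ w.Completion _ σ hinf
    rw [W.localTowerKer_eq_bot_of_forall_mem κ w.Completion m
      (fun τ ↦ κ.resGal_infinitePlace_mem_kerSubgroup w τ), AddSubgroup.mem_bot] at htow
    rw [WeierstrassCurve.mem_localKerOver_iff]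
    exact htow

/-! ## §2 Selmer classes over `K_∞` -/

/-- **Every `s ∈ Sel_{p^∞}(E/K_∞)` has, for any finite set `S` of places `v ∤ p`, a layer representative `c ∈ H¹(K_m, E[p^∞])`,
`h_m c = s`, which is LOCALLY TRIVIAL at layer `m` at every place above `S`, satisfies the classical Selmer condition at layer `m`
at every good finite `v ∤ p` and at every infinite place.** (Over `K_∞` the classical condition at `v ∤ p` IS local triviality —
`Additive.localKerOver_le_awayKer`, Greenberg's `Im κ_η = 0` — then §1.) With `S ⊇` the bad places `∤ p` this is: `c` is Selmer at
layer `m` away from `p` and ∞-adically, and locally trivial above the bad places — so in the Poitou–Tate sum at layer `m` every local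
term away from `p` that involves `c` and an everywhere-unramified-outside-`p` class vanishes. [cite: GreenbergLNM1716, §2 Prop. 2.1, §3 Lemmas 3.2–3.3]
[cite: Kobayashi2003, (7.16)–(7.18) (p. 12)] -/
theorem exists_selmer_layer_rep_awayTrivial {s : W.subgroupH1 p κ.kerSubgroup} (hs : s ∈ W.selmerInfty κ)
    (S : Finset (HeightOneSpectrum (𝓞 K))) (hSp : ∀ v ∈ S, (p : 𝓞 K) ∉ v.asIdeal) :
    ∃ (m : ℕ) (c : W.subgroupH1 p (κ.layerSubgroup m)), W.layerToInfty κ m c = s ∧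
      (∀ v ∈ S, ∀ σ : absoluteGaloisGroup K,
        resOfLe (W.geomPrimaryTorsion p) (inf_le_left : κ.layerSubgroup m ⊓ decomp v ≤ κ.layerSubgroup m)
          (W.conjH1 p (κ.layerSubgroup m) σ c) = 0) ∧
      (∀ (v : HeightOneSpectrum (𝓞 K)), v ∉ S → W.HasGoodReductionAt v → (p : 𝓞 K) ∉ v.asIdeal →
        ∀ σ : absoluteGaloisGroup K,
          W.conjH1 p (κ.layerSubgroup m) σ c ∈ W.localKerOver p (κ.layerSubgroup m) (v.adicCompletion K)) ∧
      (∀ (w : InfinitePlace K) (σ : absoluteGaloisGroup K),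
        W.conjH1 p (κ.layerSubgroup m) σ c ∈ W.localKerOver p (κ.layerSubgroup m) w.Completion) := by
  have hsel := (W.mem_selmerGroupOver_iff p κ.kerSubgroup s).1 hs
  have hS : ∀ v ∈ S, ∀ σ : absoluteGaloisGroup K,
      resOfLe (W.geomPrimaryTorsion p) (inf_le_left : κ.kerSubgroup ⊓ decomp v ≤ κ.kerSubgroup)
        (W.conjH1 p κ.kerSubgroup σ s) = 0 := fun v hv σ ↦
    localKerOver_le_awayKer (κ := κ) (v := v) (W := W) (p := p) (hSp v hv) (hsel.1 v σ)
  obtain ⟨m, c, hc, h1, h2, h3⟩ := exists_layer_forall_resOfLe_conjH1_eq_zero W p κ s S hS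
  exact ⟨m, c, hc, h1, fun v hvS hgood hpv σ ↦ h2 v hvS hgood hpv σ (hsel.1 v σ), fun w σ ↦ h3 w σ (hsel.2 w σ)⟩

/-- The same for Kobayashi's signed Selmer group `Sel^ε(E/K_∞) ≤ Sel_{p^∞}(E/K_∞)`. [cite: Kobayashi2003, Def. 1.1, (7.16)–(7.18) (p. 12)] -/
theorem exists_signedSelmer_layer_rep_awayTrivial (ε : ℤˣ) {s : W.subgroupH1 p κ.kerSubgroup}
    (hs : s ∈ signedSelmerInfty W κ ε) (S : Finset (HeightOneSpectrum (𝓞 K))) (hSp : ∀ v ∈ S, (p : 𝓞 K) ∉ v.asIdeal) :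
    ∃ (m : ℕ) (c : W.subgroupH1 p (κ.layerSubgroup m)), W.layerToInfty κ m c = s ∧
      (∀ v ∈ S, ∀ σ : absoluteGaloisGroup K,
        resOfLe (W.geomPrimaryTorsion p) (inf_le_left : κ.layerSubgroup m ⊓ decomp v ≤ κ.layerSubgroup m)
          (W.conjH1 p (κ.layerSubgroup m) σ c) = 0) ∧
      (∀ (v : HeightOneSpectrum (𝓞 K)), v ∉ S → W.HasGoodReductionAt v → (p : 𝓞 K) ∉ v.asIdeal →
        ∀ σ : absoluteGaloisGroup K,
          W.conjH1 p (κ.layerSubgroup m) σ c ∈ W.localKerOver p (κ.layerSubgroup m) (v.adicCompletion K)) ∧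
      (∀ (w : InfinitePlace K) (σ : absoluteGaloisGroup K),
        W.conjH1 p (κ.layerSubgroup m) σ c ∈ W.localKerOver p (κ.layerSubgroup m) w.Completion) :=
  exists_selmer_layer_rep_awayTrivial W p κ (signedSelmerInfty_le_selmerInfty W κ ε hs) S hSp

end SignedKatoOffTwo.LayerRep

end Summit.BirchSwinnertonDyer.BirchSwinnertonDyer.Theorems

end
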